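import Literature.Barriers.ABC.BakerMethodBoundsWeakArchProofs
import HarnessLib

/-!
# Proofs for `BakerMethodBounds`, V: the exponent `1/2` — and Stewart–Yu 1991 — from the `p`-adic clause alone

`Literature/Barriers/ABC/BakerMethodBoundsHalfExponentProofs.lean` — proofs companion of the
barrier file `Literature/Barriers/ABC/BakerMethodBounds.lean` (theorems only: no definition, no
named fact). It concerns the named fact
`Literature.Barriers.ABC.stewartYu1991_upperBound` — Stewart–Yu 1991 in Waldschmidt's form:
for every `ε > 0` there are `κ(ε)`, `c₀(ε)` with `log c ≤ κ(ε) · R^{2/3+ε}` for every abc triple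
with `c ≥ c₀(ε)`, `R = rad(abc)` [cite: Waldschmidt2014, §2 (PDF p. 3)]
[cite: StewartYu1991, main theorem] — whose only reductions in the tree so far
(`stewartYu1991_of_stewartYu`, `stewartYu1991_of_evertseGyory`, file
`BakerMethodBoundsStewartYuProofs.lean`) pass through Stewart–Yu 2001
(`BakerShapeBound (1/3) 3`), i.e. through lower bounds for linear forms in logarithms at ALL
places: Evertse–Győry's Theorem 4.2.1 over `ℚ` (Matveev + Yu + geometry of numbers), or — by
file III (`BakerMethodBoundsWeakArchProofs.lean`) — the `p`-adic clause plus an archimedean lower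
bound in `≤ 4` logarithms with an arbitrary constant.

This file proves that for the 1991 exponent NO archimedean estimate whatsoever is needed:

* `bakerShapeBound_half_three_of_padicClause`: the `p`-adic clause (ii) of Pasten's
  Theorem 2.1 alone, with any absolute `K ≥ 1`
  (`ord_p(1 − ξ) log p < K^m (p/log p) log max{e, p h(ξ)} ∏ h(ξⱼ)` for non-torsion rational
  generators `ξ₁, …, ξ_m` and `ξ = ±∏ ξⱼ^{bⱼ} ≠ 1`), gives `BakerShapeBound (1/2) 3`: an absolute
  `κ` with `log c ≤ κ · R^{1/2} (log R)³` for every abc triple;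
* `stewartYu1991_of_bakerShapeBound`: any Baker-shape bound `log c ≤ κ R^θ (log R)^m` with
  `θ ≤ 2/3` (any `m`) implies `stewartYu1991_upperBound` (`(log R)^m ≤ ((m+1)/ε)^m R^ε`);
* hence `stewartYu1991_of_padicClause`, and, through the adapters of file III and of
  `MultiplicativeGroupApproximation{GenericInputs,Thm328}Proofs.lean`,
  `stewartYu1991_of_thm328Finite` (the FINITE-place half of Evertse–Győry's Theorem 3.2.8 over
  `ℚ`), `stewartYu1991_of_yu` (Yu's Theorem 3.2.7 over `ℚ` as printed — Yu 2007 — verbatim the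
  hypothesis of `Dioph.thm328_rat_finite_of_yu`), `stewartYu1991_of_padicBound` (any `p`-adic
  bound of Yu's shape with constants `C₃(n) · 7(n+1)² ≤ C₆(n,1)`), and of course
  `stewartYu1991_of_approximationBound` (`PastenApproximationBound K`, using clause (ii) only);
* the same for the Stewart–Tijdeman shape `(15, 0)` (`stewartTijdeman1986_of_padicClause`,
  via `bakerShapeBound_mono_zero`).

So the undischarged input of `stewartYu1991_upperBound` (and of `stewartTijdeman1986_upperBound`)
is the `p`-adic theory of logarithmic forms over `ℚ` alone (Yu), with a simply-exponential
dependence of the constant on the number of logarithms; nothing at the infinite place.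

## The argument (a by-product of the reconstruction of files I–III; not claimed to be in print)

W.l.o.g. `a ≤ b` (`rad` and the shape are symmetric); the triple `1 + 1 = 2` is checked
numerically; otherwise `ab > 1`, `b ≥ 2` and `c = a + b ≤ 2b ≤ b²`, so `log c ≤ 2 log b`. Of the
three routes of file I only the route through `a` uses the archimedean clause (to pay for
`log c − log a`, which is large when `a` is small); the other two are `p`-adic
(`Y = log max{e, 2 log c}`, `Θ_{uv} = K^{ω(uv)+1} ∏_{q ∣ uv} log q`):

* (b) `log b ≤ Θ_{ac} · Y · 3 ∑_{p ∣ b} p` — `log_le_route_a₂` of file III for the swapped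
  triple `(b, a, c)`: at `p ∣ b`, `ν_p(b) = ord_p(1 − c/a)`… precisely `ord_p(1 − a/c) = ν_p(b)`,
  a linear form in the primes of `ac`;
* (c) `log c < Θ_{ab} · Y · (1 + 3 ∑_{p ∣ c} p)` — `log_lt_route_c₂` (needs `ab > 1`).

Multiplying, `(log c)² ≤ 2 (log b)(log c) ≤ 6 K² Y² · [K^{2ω(a)} Λ_a²] · [K^{ω(b)} Λ_b ∑_{p∣b} p] ·
[K^{ω(c)} Λ_c (1 + 3∑_{p∣c} p)]` (`sq_combine`; `Λ_n = ∏_{p ∣ n} log p`). The primes of `a` enter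
squared and are paid for by `member_accounting` of file I (`≤ 4K²C₂Λ² rad(a)`); the primes of `b`
and `c` enter to the FIRST power, and `member_accounting₁` (primes beat `4K log p`:
`exists_prod_mul_log_div_le`) pays `≤ 4KC₁Λ rad(w)` for each. Hence
`(log c)² ≤ 128 K⁶ C₁² C₂ Λ⁴ Y² R` (`log_sq_le_of_padicClause`), `log c ≤ D Λ² R^{1/2} · Y` with
`D = 12K³C₁C₂`, and the self-improvement `y ≤ M log max{e, 2y} ⟹ y ≤ 2M log(4M)` of file II gives
`log c ≤ 16 D (log(4D) + 3) · R^{1/2} (log R)³` (`le_of_sq_le`). The exponent `1/2` is the square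
root over the two members `b, c`; with the archimedean clause the third member joins and the cube
root gives Stewart–Yu's `1/3` (files I–III).

## References

* [StewartYu1991] C. L. Stewart, K. Yu, *On the abc conjecture*, Math. Ann. 291 (1991), 225–230,
  doi:10.1007/bf01445201 — main theorem (not held; statement as quoted by Waldschmidt).
* [Waldschmidt2014] M. Waldschmidt, *Lecture on the abc conjecture and some of its consequences*
  (2014), §2 (PDF p. 3).
* [StewartYu2001] C. L. Stewart, K. Yu, *On the abc conjecture, II*, Duke Math. J. 108 (2001),
  169–181 — Theorem 1 (the method reconstructed in files I–III).
* [Pasten2024] H. Pasten, Invent. Math. 236 (2024), 373–385 — Theorem 2.1 (ii).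
* [EvertseGyory2015] J.-H. Evertse, K. Győry, *Unit Equations in Diophantine Number Theory*,
  CUP 2015 — Thm 3.2.7, Thm 3.2.8 (p. 62), Thm 4.2.1 (p. 68).
-/

noncomputable section

open Finset Real Height
open Literature.NumberTheory.DiophantineGeometry
open Literature.NumberTheory.DiophantineGeometry.Dioph
open Literature.NumberTheory.DiophantineGeometry.Pasten

namespace Literature.Barriers.ABC

/-! ### First-power accounting: primes beat `A log p` -/

/-- **Primes beat `A log p`.** For `A ≥ 0` there is `C ≥ 1` with `∏_{p ∈ S} A (log p) / p ≤ C`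
for every finite set `S` of primes (from `exists_prod_mul_log_sq_div_le`, since
`A log p ≤ (A / log 2) (log p)²` for `p ≥ 2`). [folklore] -/
theorem exists_prod_mul_log_div_le {A : ℝ} (hA : 0 ≤ A) :
    ∃ C : ℝ, 1 ≤ C ∧ ∀ S : Finset ℕ, (∀ p ∈ S, p.Prime) →
      ∏ p ∈ S, A * Real.log p / p ≤ C := by
  have hlog2 : 0 < Real.log 2 := Real.log_pos one_lt_two
  obtain ⟨C, hC1, hC⟩ :=
    exists_prod_mul_log_sq_div_le (A := A / Real.log 2) (div_nonneg hA hlog2.le)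
  refine ⟨C, hC1, fun S hS => le_trans ?_ (hC S hS)⟩
  apply Finset.prod_le_prod
  · intro p hp
    have hp1 : (1 : ℝ) ≤ p := by exact_mod_cast (hS p hp).one_lt.le
    have : 0 ≤ Real.log p := Real.log_nonneg hp1
    positivity
  · intro p hp
    have hp2 : (2 : ℝ) ≤ p := by exact_mod_cast (hS p hp).two_le
    have hp0 : (0 : ℝ) < p := by linarith
    have hlogp : Real.log 2 ≤ Real.log p := Real.log_le_log two_pos hp2
    have hlogp0 : 0 ≤ Real.log p := hlog2.le.trans hlogp
    have key : A * Real.log p ≤ A / Real.log 2 * Real.log p ^ 2 := by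
      rw [div_mul_eq_mul_div, le_div_iff₀ hlog2, pow_two, ← mul_assoc]
      exact mul_le_mul_of_nonneg_left hlogp (mul_nonneg hA hlogp0)
    exact div_le_div_of_nonneg_right key hp0.le

/-- **Per-member accounting, first power.** For a finite set `S` of primes all `≤ e^{Λ}`
(`Λ ≥ 1`), `K ≥ 1`, and `C` bounding the products `∏ 4K(log p)/p` over finite sets of primes:
`K^{|S|} (∏_{p ∈ S} log p) (1 + 3 ∑_{p ∈ S} p) ≤ 4K · C · Λ · ∏_{p ∈ S} p` — the largest prime of
`S` is paid for by the product, its `log` by `Λ`, every other prime `q` costs `4K log q / q`.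
[folklore] -/
theorem member_accounting₁ {K C Λ : ℝ} (hK : 1 ≤ K) (hC1 : 1 ≤ C)
    (hC : ∀ S : Finset ℕ, (∀ p ∈ S, p.Prime) →
      ∏ p ∈ S, 4 * K * Real.log p / p ≤ C)
    (hΛ : 1 ≤ Λ) (S : Finset ℕ) (hS : ∀ p ∈ S, p.Prime) (hSΛ : ∀ p ∈ S, Real.log p ≤ Λ) :
    K ^ S.card * (∏ p ∈ S, Real.log p) * (1 + 3 * ∑ p ∈ S, (p : ℝ)) ≤
      4 * K * C * Λ * ∏ p ∈ S, (p : ℝ) := by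
  classical
  have hK0 : 0 ≤ K := zero_le_one.trans hK
  have hlog0 : ∀ p ∈ S, 0 ≤ Real.log p := fun p hp =>
    Real.log_nonneg (by exact_mod_cast (hS p hp).one_lt.le)
  rcases S.eq_empty_or_nonempty with rfl | hne
  · simp only [Finset.card_empty, pow_zero, Finset.prod_empty, Finset.sum_empty, mul_zero,
      add_zero, mul_one]
    calc (1 : ℝ) = 1 * 1 * 1 := by ring
      _ ≤ 4 * K * C * Λ :=
          mul_le_mul (mul_le_mul (by nlinarith) hC1 zero_le_one (by positivity)) hΛ
            zero_le_one (by positivity)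
  · -- the largest element `P` of `S`
    obtain ⟨P, hPS, hPmax⟩ := Finset.exists_max_image S id hne
    simp only [id] at hPmax
    have hP := hS P hPS
    have hP1 : (1 : ℝ) ≤ P := by exact_mod_cast hP.one_lt.le
    set T := S.erase P with hT
    have hTS : T ⊆ S := Finset.erase_subset P S
    have hcard : S.card = T.card + 1 := (Finset.card_erase_add_one hPS).symm
    have hprodlog : ∏ p ∈ S, Real.log p = Real.log P * ∏ p ∈ T, Real.log p :=
      (Finset.mul_prod_erase S (fun p => Real.log (p : ℝ)) hPS).symm
    have hprodp : ∏ p ∈ S, (p : ℝ) = P * ∏ p ∈ T, (p : ℝ) :=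
      (Finset.mul_prod_erase S (fun p => ((p : ℕ) : ℝ)) hPS).symm
    -- `1 + 3 Σ p ≤ 4^{|S|} P`
    have hsum : (1 : ℝ) + 3 * ∑ p ∈ S, (p : ℝ) ≤ 4 ^ S.card * P := by
      have h1 : ∑ p ∈ S, (p : ℝ) ≤ S.card * (P : ℝ) := by
        have := Finset.sum_le_card_nsmul S (fun p => ((p : ℕ) : ℝ)) P
          (fun p hp => by exact_mod_cast hPmax p hp)
        rwa [nsmul_eq_mul] at this
      have h2 := one_add_three_mul_le_four_pow S.card
      have h3 : (0 : ℝ) ≤ 3 * S.card := by positivity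
      calc (1 : ℝ) + 3 * ∑ p ∈ S, (p : ℝ) ≤ 1 + 3 * (S.card * P) := by linarith
        _ ≤ (1 + 3 * S.card) * P := by nlinarith
        _ ≤ 4 ^ S.card * P := mul_le_mul_of_nonneg_right h2 (by linarith)
    -- the tail product over `T`
    have hT' : ∀ p ∈ T, p.Prime := fun p hp => hS p (hTS hp)
    have hTpos : 0 < ∏ p ∈ T, (p : ℝ) :=
      Finset.prod_pos fun p hp => by exact_mod_cast (hT' p hp).pos
    have htail : ∏ p ∈ T, (4 * K * Real.log p) ≤ C * ∏ p ∈ T, (p : ℝ) := by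
      have h := hC T hT'
      rw [Finset.prod_div_distrib, div_le_iff₀ hTpos] at h
      exact h
    have htail0 : 0 ≤ ∏ p ∈ T, (4 * K * Real.log p) :=
      Finset.prod_nonneg fun p hp => by
        have := hlog0 p (hTS hp); positivity
    have hlogP : Real.log P ≤ Λ := hSΛ P hPS
    have hlogP0 : 0 ≤ Real.log P := hlog0 P hPS
    -- assemble
    have hsplit : K ^ S.card * (∏ p ∈ S, Real.log p) * (4 ^ S.card * (P : ℝ)) =
        4 * K * Real.log P * P * ∏ p ∈ T, (4 * K * Real.log p) := by
      rw [hprodlog, hcard, Finset.prod_mul_distrib, Finset.prod_const]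
      ring
    have hLHS0 : 0 ≤ K ^ S.card * ∏ p ∈ S, Real.log p :=
      mul_nonneg (pow_nonneg hK0 _) (Finset.prod_nonneg hlog0)
    calc K ^ S.card * (∏ p ∈ S, Real.log p) * (1 + 3 * ∑ p ∈ S, (p : ℝ))
        ≤ K ^ S.card * (∏ p ∈ S, Real.log p) * (4 ^ S.card * (P : ℝ)) :=
          mul_le_mul_of_nonneg_left hsum hLHS0
      _ = 4 * K * Real.log P * P * ∏ p ∈ T, (4 * K * Real.log p) := hsplit
      _ ≤ 4 * K * Λ * P * (C * ∏ p ∈ T, (p : ℝ)) := by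
          apply mul_le_mul _ htail htail0 (by positivity)
          apply mul_le_mul_of_nonneg_right _ (by linarith)
          exact mul_le_mul_of_nonneg_left hlogP (by positivity)
      _ = 4 * K * C * Λ * (P * ∏ p ∈ T, (p : ℝ)) := by ring
      _ = 4 * K * C * Λ * ∏ p ∈ S, (p : ℝ) := by rw [hprodp]

/-! ### The square of the two `p`-adic routes -/

/-- **The product of the routes through `b` and `c`** (pure algebra): from `y ≤ 2 ℓ_b`, the two
route bounds and the three accountings, `y² ≤ 2 K² Y² · B_a B_b B_c`. [folklore] -/
theorem sq_combine {K Y y lb La Lb Lc sb sc Ba Bb Bc : ℝ} {ta tb tc : ℕ}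
    (hK : 0 ≤ K) (hy : 0 ≤ y) (hY : 0 ≤ Y) (hLa : 0 ≤ La) (hLb : 0 ≤ Lb) (hLc : 0 ≤ Lc)
    (hsb : 0 ≤ sb) (hsc : 0 ≤ sc)
    (hyb : y ≤ 2 * lb)
    (hB : lb ≤ K ^ (ta + tc + 1) * (La * Lc) * Y * (3 * sb))
    (hC : y < K ^ (ta + tb + 1) * (La * Lb) * Y * (1 + 3 * sc))
    (hXa : K ^ (2 * ta) * La ^ 2 ≤ Ba)
    (hXb : K ^ tb * Lb * (1 + 3 * sb) ≤ Bb)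
    (hXc : K ^ tc * Lc * (1 + 3 * sc) ≤ Bc) :
    y ^ 2 ≤ 2 * K ^ 2 * Y ^ 2 * (Ba * Bb * Bc) := by
  have hB0 : 0 ≤ K ^ (ta + tc + 1) * (La * Lc) * Y * (3 * sb) := by positivity
  have h1 : y ^ 2 ≤ (2 * (K ^ (ta + tc + 1) * (La * Lc) * Y * (3 * sb))) *
      (K ^ (ta + tb + 1) * (La * Lb) * Y * (1 + 3 * sc)) := by
    rw [pow_two]
    exact mul_le_mul (hyb.trans (by linarith)) hC.le hy (by positivity)
  have hident : (2 * (K ^ (ta + tc + 1) * (La * Lc) * Y * (3 * sb))) *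
      (K ^ (ta + tb + 1) * (La * Lb) * Y * (1 + 3 * sc)) =
      2 * K ^ 2 * Y ^ 2 * ((K ^ (2 * ta) * La ^ 2) * (K ^ tb * Lb * (3 * sb)) *
        (K ^ tc * Lc * (1 + 3 * sc))) := by
    ring
  rw [hident] at h1
  have hXb' : K ^ tb * Lb * (3 * sb) ≤ Bb :=
    le_trans (mul_le_mul_of_nonneg_left (by linarith) (by positivity)) hXb
  have h0a : 0 ≤ K ^ (2 * ta) * La ^ 2 := by positivity
  have h0b : 0 ≤ K ^ tb * Lb * (3 * sb) := by positivity
  have h0c : 0 ≤ K ^ tc * Lc * (1 + 3 * sc) := by positivity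
  refine h1.trans (mul_le_mul_of_nonneg_left ?_ (by positivity))
  exact mul_le_mul (mul_le_mul hXa hXb' h0b (h0a.trans hXa)) hXc h0c
    (mul_nonneg (h0a.trans hXa) (h0b.trans hXb'))

section PadicOnly

variable {K : ℝ}

/-- **The square of the two `p`-adic routes for an abc triple** with `a ≤ b` and `ab > 1`, from
the `p`-adic clause (ii) of the approximation bound alone (`K ≥ 1`):
`(log c)² ≤ 128 K⁶ C₁² C₂ Λ⁴ Y² R`, where `R = rad(abc)`, `Λ = max(1, log R)`,
`Y = log max{e, 2 log c}`, `C₁` bounds the products `∏ 4K(log p)/p` and `C₂` the products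
`∏ 4K²(log p)²/p` over finite sets of primes. Routes: `log_le_route_a₂` for `(b, a, c)` and
`log_lt_route_c₂`; `log c ≤ 2 log b` since `c ≤ 2b ≤ b²`.
[cite: StewartYu2001, Theorem 1 (method), as reconstructed in `BakerMethodBoundsThreeRoutesProofs`] -/
theorem log_sq_le_of_padicClause (hK : 1 ≤ K)
    (hP2 : ∀ (ι : Type) [Fintype ι], 0 < Fintype.card ι →
      ∀ ξ : ι → ℚ, (∀ i, ξ i ≠ 0 ∧ ξ i ≠ 1 ∧ ξ i ≠ -1) →
      ∀ ζ : ℚ, (ζ = 1 ∨ ζ = -1) → ∀ b : ι → ℤ, ζ * ∏ i, ξ i ^ b i ≠ 1 →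
      ∀ p : ℕ, p.Prime →
        (padicValRat p (1 - ζ * ∏ i, ξ i ^ b i) : ℝ) * Real.log p <
          K ^ Fintype.card ι * (p / Real.log p) *
            Real.log (max (Real.exp 1) (p * logHeight₁ (ζ * ∏ i, ξ i ^ b i))) *
            ∏ i, logHeight₁ (ξ i))
    {C₁ C₂ : ℝ} (hC₁1 : 1 ≤ C₁)
    (hC₁ : ∀ S : Finset ℕ, (∀ p ∈ S, p.Prime) → ∏ p ∈ S, 4 * K * Real.log p / p ≤ C₁)
    (hC₂1 : 1 ≤ C₂)
    (hC₂ : ∀ S : Finset ℕ, (∀ p ∈ S, p.Prime) → ∏ p ∈ S, 4 * K ^ 2 * Real.log p ^ 2 / p ≤ C₂)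
    {a b c : ℕ} (h : IsABCTriple a b c) (hab : a ≤ b) (h1 : 1 < a * b) :
    Real.log c ^ 2 ≤ 128 * K ^ 6 * C₁ ^ 2 * C₂ * max 1 (Real.log (rad a b c : ℕ)) ^ 4 *
      Real.log (max (Real.exp 1) (2 * Real.log c)) ^ 2 * (rad a b c : ℝ) := by
  obtain ⟨ha, hb, habc, hcop⟩ := id h
  have hc : c ≠ 0 := by omega
  have hbc : b.Coprime c := coprime_right_of_isABCTriple h
  have hac : a.Coprime c := coprime_left_of_isABCTriple h
  have habc0 : a * b * c ≠ 0 := by positivity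
  have hK0 : 0 ≤ K := zero_le_one.trans hK
  -- `b ≥ 2`, `c ≤ b²`, `log c ≤ 2 log b`
  have hb2 : 2 ≤ b := by
    by_contra hlt
    have hb1 : b = 1 := by omega
    have ha1 : a = 1 := by omega
    rw [ha1, hb1] at h1
    exact lt_irrefl _ h1
  have hcb : c ≤ b ^ 2 := by nlinarith
  have hy0 : 0 ≤ Real.log c := Real.log_nonneg (by exact_mod_cast Nat.one_le_iff_ne_zero.mpr hc)
  have hyb : Real.log c ≤ 2 * Real.log b := by
    have h2 : Real.log ((b : ℝ) ^ 2) = 2 * Real.log b := by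
      rw [Real.log_pow]; push_cast; ring
    rw [← h2]
    exact Real.log_le_log (by exact_mod_cast Nat.pos_of_ne_zero hc) (by exact_mod_cast hcb)
  have hY0 : 0 ≤ Real.log (max (Real.exp 1) (2 * Real.log c)) :=
    zero_le_one.trans (one_le_log_max_exp _)
  have hΛ1 : 1 ≤ max 1 (Real.log (rad a b c : ℕ)) := le_max_left _ _
  -- the two routes
  have hB := log_le_route_a₂ hK hP2 h.swap
  have hCc := log_lt_route_c₂ hK hP2 h h1
  rw [theta_zero_eq_split K ha.ne' hc hac] at hB
  rw [theta_zero_eq_split K ha.ne' hb.ne' hcop] at hCc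
  -- per-member accounting
  have hprime : ∀ n : ℕ, ∀ p ∈ n.primeFactors, p.Prime := fun n p hp =>
    Nat.prime_of_mem_primeFactors hp
  have hlogle : ∀ {n : ℕ}, n ∣ a * b * c → ∀ p ∈ n.primeFactors,
      Real.log p ≤ max 1 (Real.log (rad a b c : ℕ)) := by
    intro n hn p hp
    have hp' := Nat.prime_of_mem_primeFactors hp
    have hpR : (p : ℝ) ≤ (rad a b c : ℝ) := by
      exact_mod_cast prime_le_rad hp' ((Nat.dvd_of_mem_primeFactors hp).trans hn) habc0
    have hp0 : (0 : ℝ) < p := by exact_mod_cast hp'.pos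
    exact (Real.log_le_log hp0 hpR).trans (le_max_right _ _)
  have hXa := member_accounting hK hC₂1 hC₂ hΛ1 a.primeFactors (hprime a)
    (hlogle (Dvd.intro (b * c) (by ring)))
  have hXb := member_accounting₁ hK hC₁1 hC₁ hΛ1 b.primeFactors (hprime b)
    (hlogle (Dvd.intro (a * c) (by ring)))
  have hXc := member_accounting₁ hK hC₁1 hC₁ hΛ1 c.primeFactors (hprime c)
    (hlogle (Dvd.intro_left (a * b) rfl))
  have hsum0 : ∀ n : ℕ, 0 ≤ ∑ p ∈ n.primeFactors, ((p : ℕ) : ℝ) := fun n =>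
    Finset.sum_nonneg fun p _ => Nat.cast_nonneg p
  have hlog0 : ∀ n : ℕ, 0 ≤ ∏ p ∈ n.primeFactors, Real.log (p : ℝ) := fun n =>
    (prod_log_primeFactors_pos n).le
  have hXa' : K ^ (2 * a.primeFactors.card) * (∏ p ∈ a.primeFactors, Real.log (p : ℝ)) ^ 2 ≤
      4 * K ^ 2 * C₂ * max 1 (Real.log (rad a b c : ℕ)) ^ 2 * ∏ p ∈ a.primeFactors, (p : ℝ) := by
    refine le_trans ?_ hXa
    refine le_mul_of_one_le_right (by positivity) ?_
    linarith [hsum0 a]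
  -- the radical
  have hRprod : ((rad a b c : ℕ) : ℝ) = (∏ p ∈ a.primeFactors, (p : ℝ)) *
      (∏ p ∈ b.primeFactors, (p : ℝ)) * ∏ p ∈ c.primeFactors, (p : ℝ) := by
    rw [rad_def, Nat.radical_eq_prod_primeFactors, Nat.cast_prod,
      prod_primeFactors_mul_of_coprime (mul_ne_zero ha.ne' hb.ne') hc (Nat.Coprime.mul_left hac hbc),
      prod_primeFactors_mul_of_coprime ha.ne' hb.ne' hcop]
  have key := sq_combine hK0 hy0 hY0 (hlog0 a) (hlog0 b) (hlog0 c) (hsum0 b) (hsum0 c)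
    hyb hB hCc hXa' hXb hXc
  calc Real.log c ^ 2 ≤ _ := key
    _ = 128 * K ^ 6 * C₁ ^ 2 * C₂ * max 1 (Real.log (rad a b c : ℕ)) ^ 4 *
          Real.log (max (Real.exp 1) (2 * Real.log c)) ^ 2 *
          ((∏ p ∈ a.primeFactors, (p : ℝ)) * (∏ p ∈ b.primeFactors, (p : ℝ)) *
            ∏ p ∈ c.primeFactors, (p : ℝ)) := by ring
    _ = _ := by rw [hRprod]

/-- **From the square to the bound** (pure analysis): if `R ≥ 2`, `D ≥ 1` and
`y² ≤ D² Λ⁴ Y² R` with `Λ = max(1, log R)`, `Y = log max{e, 2y}`, then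
`y ≤ 16 D (log(4D) + 3) · R^{1/2} (log R)³`. [folklore] -/
theorem le_of_sq_le {D R y : ℝ} (hD : 1 ≤ D) (hR : 2 ≤ R)
    (h : y ^ 2 ≤ D ^ 2 * max 1 (Real.log R) ^ 4 *
      Real.log (max (Real.exp 1) (2 * y)) ^ 2 * R) :
    y ≤ 16 * D * (Real.log (4 * D) + 3) * R ^ (1 / 2 : ℝ) * Real.log R ^ 3 := by
  set L : ℝ := Real.log R with hL
  set Λ : ℝ := max 1 L with hΛ
  set Y : ℝ := Real.log (max (Real.exp 1) (2 * y)) with hYdef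
  set c₀ : ℝ := Real.log (4 * D) with hc₀
  set M : ℝ := D * Λ ^ 2 * R ^ (1 / 2 : ℝ) with hM
  have hR0 : 0 < R := by linarith
  have hD0 : 0 < D := by linarith
  have hY1 : 1 ≤ Y := one_le_log_max_exp _
  have hΛ1 : 1 ≤ Λ := le_max_left _ _
  have hR12 : (R ^ (1 / 2 : ℝ)) ^ 2 = R := by
    rw [← Real.rpow_mul_natCast hR0.le]; norm_num
  have hR12_1 : 1 ≤ R ^ (1 / 2 : ℝ) := Real.one_le_rpow (by linarith) (by norm_num)
  have hM1 : 1 ≤ M := by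
    have h2 : (1 : ℝ) ≤ Λ ^ 2 := one_le_pow₀ hΛ1
    calc (1 : ℝ) = 1 * 1 * 1 := by ring
      _ ≤ D * Λ ^ 2 * R ^ (1 / 2 : ℝ) :=
          mul_le_mul (mul_le_mul hD h2 zero_le_one hD0.le) hR12_1 zero_le_one (by positivity)
  have hMY : (M * Y) ^ 2 = D ^ 2 * Λ ^ 4 * Y ^ 2 * R := by
    calc (M * Y) ^ 2 = D ^ 2 * Λ ^ 4 * Y ^ 2 * (R ^ (1 / 2 : ℝ)) ^ 2 := by rw [hM]; ring
      _ = _ := by rw [hR12]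
  have h1 : y ≤ M * Y := by
    refine le_of_pow_le_pow_left₀ (by norm_num : (2 : ℕ) ≠ 0) (by positivity) ?_
    rw [hMY]; exact h
  have h2 : y ≤ 2 * M * Real.log (4 * M) := le_of_le_mul_log_max hM1 h1
  -- `log(4M) ≤ (c₀ + 3) Λ`
  have hc₀0 : 0 ≤ c₀ := Real.log_nonneg (by linarith)
  have hlog4M : Real.log (4 * M) ≤ (c₀ + 3) * Λ := by
    have h4M : 4 * M = (4 * D) * (Λ ^ 2 * R ^ (1 / 2 : ℝ)) := by rw [hM]; ring
    have hΛ0 : 0 < Λ := by linarith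
    have hx : (4 * D) ≠ 0 := by positivity
    have hy' : Λ ^ 2 * R ^ (1 / 2 : ℝ) ≠ 0 := by positivity
    have hexp : Real.log (4 * M) = c₀ + 2 * Real.log Λ + 1 / 2 * L := by
      rw [h4M, Real.log_mul hx hy', Real.log_mul (x := Λ ^ 2) (y := R ^ (1 / 2 : ℝ))
        (by positivity) (by positivity), Real.log_pow, Real.log_rpow hR0, hc₀, hL]
      push_cast
      ring
    have hlogΛ : Real.log Λ ≤ Λ := Real.log_le_self hΛ0.le
    have hLΛ : L ≤ Λ := le_max_right _ _
    have hc₀Λ : c₀ ≤ c₀ * Λ := le_mul_of_one_le_right hc₀0 hΛ1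
    rw [hexp]
    nlinarith
  -- `Λ ≤ 2 L`
  have hL2 : Real.log 2 ≤ L := Real.log_le_log two_pos hR
  have hlog2 : (1 / 2 : ℝ) ≤ Real.log 2 := by have := Real.log_two_gt_d9; linarith
  have hL0 : 0 ≤ L := by linarith
  have hΛL : Λ ≤ 2 * L := max_le (by linarith) (by linarith)
  have hM0 : 0 ≤ M := by linarith
  calc y ≤ 2 * M * Real.log (4 * M) := h2
    _ ≤ 2 * M * ((c₀ + 3) * Λ) := mul_le_mul_of_nonneg_left hlog4M (by positivity)
    _ = 2 * D * (c₀ + 3) * R ^ (1 / 2 : ℝ) * Λ ^ 3 := by rw [hM]; ring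
    _ ≤ 2 * D * (c₀ + 3) * R ^ (1 / 2 : ℝ) * (2 * L) ^ 3 := by
        apply mul_le_mul_of_nonneg_left (pow_le_pow_left₀ (by linarith) hΛL 3) (by positivity)
    _ = 16 * D * (c₀ + 3) * R ^ (1 / 2 : ℝ) * L ^ 3 := by ring

/-- **The exponent `1/2` from the `p`-adic clause alone.** If the `p`-adic clause (ii) of
Pasten's approximation bound holds with some absolute `K ≥ 1` (lower bounds for linear forms in
`p`-adic logarithms over `ℚ` with a simply-exponential constant — Yu), then
`BakerShapeBound (1/2) 3`: there is `κ` with `log c ≤ κ · R^{1/2} (log R)³` for every abc triple.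
No archimedean estimate is used. Proof: w.l.o.g. `a ≤ b`; the triple `1 + 1 = 2` directly;
otherwise `log_sq_le_of_padicClause` and `le_of_sq_le`.
[cite: StewartYu2001, Theorem 1 (method), as reconstructed in `BakerMethodBoundsThreeRoutesProofs`] -/
theorem bakerShapeBound_half_three_of_padicClause (hK : 1 ≤ K)
    (hP2 : ∀ (ι : Type) [Fintype ι], 0 < Fintype.card ι →
      ∀ ξ : ι → ℚ, (∀ i, ξ i ≠ 0 ∧ ξ i ≠ 1 ∧ ξ i ≠ -1) →
      ∀ ζ : ℚ, (ζ = 1 ∨ ζ = -1) → ∀ b : ι → ℤ, ζ * ∏ i, ξ i ^ b i ≠ 1 →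
      ∀ p : ℕ, p.Prime →
        (padicValRat p (1 - ζ * ∏ i, ξ i ^ b i) : ℝ) * Real.log p <
          K ^ Fintype.card ι * (p / Real.log p) *
            Real.log (max (Real.exp 1) (p * logHeight₁ (ζ * ∏ i, ξ i ^ b i))) *
            ∏ i, logHeight₁ (ξ i)) :
    BakerShapeBound (1 / 2) 3 := by
  obtain ⟨C₂, hC₂1, hC₂⟩ := exists_prod_mul_log_sq_div_le (show (0 : ℝ) ≤ 4 * K ^ 2 by positivity)
  obtain ⟨C₁, hC₁1, hC₁⟩ := exists_prod_mul_log_div_le (show (0 : ℝ) ≤ 4 * K by positivity)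
  set D : ℝ := 12 * K ^ 3 * C₁ * C₂ with hD
  have hK3 : 1 ≤ K ^ 3 := one_le_pow₀ hK
  have hKC : 1 ≤ K ^ 3 * C₁ * C₂ := by
    calc (1 : ℝ) = 1 * 1 * 1 := by ring
      _ ≤ K ^ 3 * C₁ * C₂ :=
          mul_le_mul (mul_le_mul hK3 hC₁1 zero_le_one (by positivity)) hC₂1 zero_le_one
            (by positivity)
  have hD12 : 12 ≤ D := by rw [hD]; linarith
  have hD1 : 1 ≤ D := by linarith
  have hc₀0 : 0 ≤ Real.log (4 * D) := Real.log_nonneg (by linarith)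
  suffices main : ∀ a b c : ℕ, IsABCTriple a b c → a ≤ b →
      Real.log c ≤ 16 * D * (Real.log (4 * D) + 3) * (rad a b c : ℝ) ^ (1 / 2 : ℝ) *
        Real.log (rad a b c : ℕ) ^ 3 by
    refine ⟨16 * D * (Real.log (4 * D) + 3), fun a b c h => ?_⟩
    rcases le_total a b with hab | hba
    · exact main a b c h hab
    · have := main b a c h.swap hba
      rwa [rad_swap] at this
  intro a b c h hab
  obtain ⟨ha, hb, habc, hcop⟩ := id h
  have hR2 : (2 : ℝ) ≤ (rad a b c : ℝ) := by
    have : 2 ≤ rad a b c := by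
      rw [rad_def, Nat.two_le_radical_iff]
      calc 2 ≤ c := by omega
        _ ≤ a * b * c := Nat.le_mul_of_pos_left c (Nat.mul_pos ha hb)
    exact_mod_cast this
  by_cases h1 : 1 < a * b
  · have hsq := log_sq_le_of_padicClause hK hP2 hC₁1 hC₁ hC₂1 hC₂ h hab h1
    apply le_of_sq_le hD1 hR2
    refine hsq.trans ?_
    have hC₂sq : C₂ ≤ C₂ ^ 2 := by nlinarith
    have hcoef : 128 * K ^ 6 * C₁ ^ 2 * C₂ ≤ D ^ 2 := by
      have hD2 : D ^ 2 = 144 * K ^ 6 * C₁ ^ 2 * C₂ ^ 2 := by rw [hD]; ring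
      have h₁ : K ^ 6 * C₁ ^ 2 * C₂ ≤ K ^ 6 * C₁ ^ 2 * C₂ ^ 2 :=
        mul_le_mul_of_nonneg_left hC₂sq (by positivity)
      have h₂ : 0 ≤ K ^ 6 * C₁ ^ 2 * C₂ := by positivity
      rw [hD2]
      nlinarith
    exact mul_le_mul_of_nonneg_right (mul_le_mul_of_nonneg_right
      (mul_le_mul_of_nonneg_right hcoef (by positivity)) (by positivity)) (by positivity)
  · -- the triple `1 + 1 = 2`
    have hab1 : a * b = 1 := by
      have : 1 ≤ a * b := Nat.mul_pos ha hb
      omega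
    have ha1 : a = 1 := Nat.eq_one_of_mul_eq_one_right hab1
    have hb1 : b = 1 := Nat.eq_one_of_mul_eq_one_left hab1
    have hc2 : c = 2 := by omega
    set R : ℝ := ((rad a b c : ℕ) : ℝ) with hR
    have hκ : (576 : ℝ) ≤ 16 * D * (Real.log (4 * D) + 3) := by
      have h3 : (3 : ℝ) ≤ Real.log (4 * D) + 3 := by linarith
      calc (576 : ℝ) = 16 * 12 * 3 := by norm_num
        _ ≤ 16 * D * (Real.log (4 * D) + 3) :=
            mul_le_mul (mul_le_mul_of_nonneg_left hD12 (by norm_num)) h3 (by norm_num)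
              (by positivity)
    have hR12 : 1 ≤ R ^ (1 / 2 : ℝ) := Real.one_le_rpow (by linarith) (by norm_num)
    have hL : (0.69 : ℝ) ≤ Real.log R :=
      le_trans (by have := Real.log_two_gt_d9; linarith) (Real.log_le_log two_pos hR2)
    have hL3 : (0.69 : ℝ) ^ 3 ≤ Real.log R ^ 3 := pow_le_pow_left₀ (by norm_num) hL 3
    have hlog2 : Real.log 2 ≤ 0.7 := by have := Real.log_two_lt_d9; linarith
    calc Real.log c = Real.log 2 := by rw [hc2]; norm_num
      _ ≤ 0.7 := hlog2
      _ ≤ 576 * 1 * (0.69 : ℝ) ^ 3 := by norm_num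
      _ ≤ 16 * D * (Real.log (4 * D) + 3) * R ^ (1 / 2 : ℝ) * Real.log R ^ 3 :=
          mul_le_mul (mul_le_mul hκ hR12 zero_le_one (by linarith)) hL3 (by norm_num)
            (by positivity)

/-- **`BakerShapeBound (1/2) 3` from the approximation bound**, using its `p`-adic clause only.
[cite: Pasten2024, Theorem 2.1 (ii)] -/
theorem bakerShapeBound_half_three_of_approximationBound (hK : 1 ≤ K)
    (hP : PastenApproximationBound K) : BakerShapeBound (1 / 2) 3 :=
  bakerShapeBound_half_three_of_padicClause hK
    fun ι _ hι ξ hξ ζ hζ b hx p hp => (hP ι hι ξ hξ ζ hζ b hx).2 p hp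

end PadicOnly

/-! ### Stewart–Yu 1991 from any Baker-shape bound with `θ ≤ 2/3` -/

/-- **The 1991 shape from any shape `(θ, m)` with `θ ≤ 2/3`.** If `log c ≤ κ R^θ (log R)^m` for
all abc triples, then for every `ε > 0`, `log c ≤ κ(ε) R^{2/3+ε}` for all abc triples (no
largeness condition needed: `c₀ = 0`), with `κ(ε) = |κ| ((m+1)/ε)^m`: indeed
`log R ≤ R^δ/δ` for `δ = ε/(m+1)`, so `(log R)^m ≤ δ^{-m} R^{mδ} ≤ δ^{-m} R^ε`, and
`R^θ ≤ R^{2/3}` for `R ≥ 1`. [folklore] -/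
theorem stewartYu1991_of_bakerShapeBound {θ : ℝ} {m : ℕ} (hθ : θ ≤ 2 / 3)
    (h : BakerShapeBound θ m) : stewartYu1991_upperBound := by
  obtain ⟨κ, hκ⟩ := h
  intro ε hε
  set δ : ℝ := ε / (m + 1) with hδ
  have hm0 : (0 : ℝ) < m + 1 := by positivity
  have hδ0 : 0 < δ := div_pos hε hm0
  refine ⟨|κ| / δ ^ m, 0, fun a b c ht _ => ?_⟩
  have h1 := hκ a b c ht
  have hR : (1 : ℝ) ≤ (rad a b c : ℝ) := one_le_rad_real a b c
  set R : ℝ := (rad a b c : ℝ) with hRdef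
  have hR0 : 0 < R := by linarith
  have hlog0 : 0 ≤ Real.log R := Real.log_nonneg hR
  -- `(log R)^m ≤ R^ε / δ^m`
  have hlog : Real.log R ≤ R ^ δ / δ := Real.log_le_rpow_div hR0.le hδ0
  have hδm : δ * m ≤ ε := by
    rw [hδ, div_mul_eq_mul_div, div_le_iff₀ hm0]
    nlinarith
  have hpow : Real.log R ^ m ≤ R ^ ε / δ ^ m := by
    calc Real.log R ^ m ≤ (R ^ δ / δ) ^ m := pow_le_pow_left₀ hlog0 hlog m
      _ = R ^ (δ * m) / δ ^ m := by rw [div_pow, Real.rpow_mul_natCast hR0.le]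
      _ ≤ R ^ ε / δ ^ m := by
          apply div_le_div_of_nonneg_right _ (pow_nonneg hδ0.le m)
          exact Real.rpow_le_rpow_of_exponent_le hR hδm
  have hθ' : R ^ θ ≤ R ^ (2 / 3 : ℝ) := Real.rpow_le_rpow_of_exponent_le hR hθ
  have hsplit : R ^ (2 / 3 : ℝ) * R ^ ε = R ^ (2 / 3 + ε : ℝ) := by
    rw [← Real.rpow_add hR0]
  have hA : 0 ≤ R ^ θ * Real.log R ^ m := by positivity
  have hδm0 : 0 < δ ^ m := pow_pos hδ0 m
  calc Real.log c ≤ κ * R ^ θ * Real.log R ^ m := h1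
    _ ≤ |κ| * (R ^ θ * Real.log R ^ m) := by
        rw [mul_assoc]; exact mul_le_mul_of_nonneg_right (le_abs_self κ) hA
    _ ≤ |κ| * (R ^ (2 / 3 : ℝ) * (R ^ ε / δ ^ m)) := by
        apply mul_le_mul_of_nonneg_left _ (abs_nonneg κ)
        exact mul_le_mul hθ' hpow (by positivity) (by positivity)
    _ = |κ| / δ ^ m * (R ^ (2 / 3 : ℝ) * R ^ ε) := by
        field_simp
    _ = |κ| / δ ^ m * R ^ (2 / 3 + ε : ℝ) := by rw [hsplit]

/-- **Monotonicity of the shape towards `m = 0`:** `log c ≤ κ R^θ (log R)^m` implies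
`log c ≤ |κ| R^{θ'}` whenever `θ + m ≤ θ'` (`log R ≤ R`, `R ≥ 1`). [folklore] -/
theorem bakerShapeBound_mono_zero {θ θ' : ℝ} {m : ℕ} (hθ : θ + m ≤ θ')
    (h : BakerShapeBound θ m) : BakerShapeBound θ' 0 := by
  obtain ⟨κ, hκ⟩ := h
  refine ⟨|κ|, fun a b c ht => ?_⟩
  have h1 := hκ a b c ht
  have hR : (1 : ℝ) ≤ (rad a b c : ℝ) := one_le_rad_real a b c
  set R : ℝ := (rad a b c : ℝ) with hRdef
  have hR0 : 0 < R := by linarith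
  have hlog0 : 0 ≤ Real.log R := Real.log_nonneg hR
  have hlogR : Real.log R ≤ R := (Real.log_le_sub_one_of_pos hR0).trans (by linarith)
  have hA : 0 ≤ R ^ θ * Real.log R ^ m := by positivity
  calc Real.log c ≤ κ * R ^ θ * Real.log R ^ m := h1
    _ ≤ |κ| * (R ^ θ * Real.log R ^ m) := by
        rw [mul_assoc]; exact mul_le_mul_of_nonneg_right (le_abs_self κ) hA
    _ ≤ |κ| * (R ^ θ * R ^ (m : ℝ)) := by
        apply mul_le_mul_of_nonneg_left _ (abs_nonneg κ)
        apply mul_le_mul_of_nonneg_left _ (by positivity)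
        rw [Real.rpow_natCast]
        exact pow_le_pow_left₀ hlog0 hlogR m
    _ = |κ| * R ^ (θ + m : ℝ) := by rw [← Real.rpow_add hR0]
    _ ≤ |κ| * R ^ θ' := mul_le_mul_of_nonneg_left
        (Real.rpow_le_rpow_of_exponent_le hR hθ) (abs_nonneg κ)
    _ = |κ| * R ^ θ' * Real.log R ^ 0 := by rw [pow_zero, mul_one]

/-! ### Stewart–Yu 1991 (and Stewart–Tijdeman 1986) from the `p`-adic inputs alone -/

section Corollaries

variable {K : ℝ}

/-- **Stewart–Yu 1991 (`stewartYu1991_upperBound`) from the `p`-adic clause alone** (any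
absolute `K ≥ 1`; no archimedean input). [cite: Waldschmidt2014, §2 (PDF p. 3)]
[cite: StewartYu1991, main theorem] -/
theorem stewartYu1991_of_padicClause (hK : 1 ≤ K)
    (hP2 : ∀ (ι : Type) [Fintype ι], 0 < Fintype.card ι →
      ∀ ξ : ι → ℚ, (∀ i, ξ i ≠ 0 ∧ ξ i ≠ 1 ∧ ξ i ≠ -1) →
      ∀ ζ : ℚ, (ζ = 1 ∨ ζ = -1) → ∀ b : ι → ℤ, ζ * ∏ i, ξ i ^ b i ≠ 1 →
      ∀ p : ℕ, p.Prime →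
        (padicValRat p (1 - ζ * ∏ i, ξ i ^ b i) : ℝ) * Real.log p <
          K ^ Fintype.card ι * (p / Real.log p) *
            Real.log (max (Real.exp 1) (p * logHeight₁ (ζ * ∏ i, ξ i ^ b i))) *
            ∏ i, logHeight₁ (ξ i)) :
    stewartYu1991_upperBound :=
  stewartYu1991_of_bakerShapeBound (by norm_num) (bakerShapeBound_half_three_of_padicClause hK hP2)

/-- **Stewart–Tijdeman 1986 (`stewartTijdeman1986_upperBound = BakerShapeBound 15 0`) from the
`p`-adic clause alone.** [cite: StewartTijdeman1986, Theorem 1 (upper bound), as quoted in Waldschmidt2014 §2] -/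
theorem stewartTijdeman1986_of_padicClause (hK : 1 ≤ K)
    (hP2 : ∀ (ι : Type) [Fintype ι], 0 < Fintype.card ι →
      ∀ ξ : ι → ℚ, (∀ i, ξ i ≠ 0 ∧ ξ i ≠ 1 ∧ ξ i ≠ -1) →
      ∀ ζ : ℚ, (ζ = 1 ∨ ζ = -1) → ∀ b : ι → ℤ, ζ * ∏ i, ξ i ^ b i ≠ 1 →
      ∀ p : ℕ, p.Prime →
        (padicValRat p (1 - ζ * ∏ i, ξ i ^ b i) : ℝ) * Real.log p <
          K ^ Fintype.card ι * (p / Real.log p) *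
            Real.log (max (Real.exp 1) (p * logHeight₁ (ζ * ∏ i, ξ i ^ b i))) *
            ∏ i, logHeight₁ (ξ i)) :
    stewartTijdeman1986_upperBound :=
  bakerShapeBound_mono_zero (by norm_num) (bakerShapeBound_half_three_of_padicClause hK hP2)

/-- **Stewart–Yu 1991 from the approximation bound** (its `p`-adic clause only).
[cite: Pasten2024, Theorem 2.1 (ii)] [cite: Waldschmidt2014, §2 (PDF p. 3)] -/
theorem stewartYu1991_of_approximationBound (hK : 1 ≤ K) (hP : PastenApproximationBound K) :
    stewartYu1991_upperBound :=
  stewartYu1991_of_bakerShapeBound (by norm_num)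
    (bakerShapeBound_half_three_of_approximationBound hK hP)

/-- **`BakerShapeBound (1/2) 3` from Evertse–Győry's Theorem 3.2.8 over `ℚ` at the FINITE
places only** (the hypothesis is the finite-place half of the printed Theorem 3.2.8 for `K = ℚ`,
as in `Dioph.evertseGyory_thm_4_2_1_rat_of_thm_3_2_8`; adapter `padicClause_of_thm328_finite`
of file III). [cite: EvertseGyory2015, Thm 3.2.8 (p. 62)] -/
theorem bakerShapeBound_half_three_of_thm328Finite
    (h328 : ∀ (ι : Type) [Fintype ι], 0 < Fintype.card ι →
      ∀ α : ι → ℚ, (∀ i, α i ≠ 0 ∧ α i ≠ 1 ∧ α i ≠ -1) →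
      ∀ β : ℚ, β ≠ 0 → ∀ s : ℤ, (s = 1 ∨ s = -1) → ∀ b : ι → ℤ,
        (∏ i, α i ^ b i) * β ^ s - 1 ≠ 0 →
      ∀ B : ℝ, (∀ i, (|b i| : ℝ) ≤ B) →
        2 * Real.exp 1 * 9 ^ (Fintype.card ι + 1) * (∏ i, logHeight₁ (α i)) *
            max (logHeight₁ β) 1 ≤ B →
        ∀ p : ℕ, p.Prime →
          -(egC6 (Fintype.card ι + 1) * (p / Real.log p) * (∏ i, logHeight₁ (α i)) *
              max (logHeight₁ β) 1 * logStar (B * p / max (logHeight₁ β) 1)) <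
            -(padicValRat p ((∏ i, α i ^ b i) * β ^ s - 1) : ℝ) * Real.log p) :
    BakerShapeBound (1 / 2) 3 :=
  bakerShapeBound_half_three_of_padicClause one_le_pastenK (padicClause_of_thm328_finite h328)

/-- **Stewart–Yu 1991 from the finite-place half of Evertse–Győry's Theorem 3.2.8 over `ℚ`.**
[cite: EvertseGyory2015, Thm 3.2.8 (p. 62)] [cite: Waldschmidt2014, §2 (PDF p. 3)] -/
theorem stewartYu1991_of_thm328Finite
    (h328 : ∀ (ι : Type) [Fintype ι], 0 < Fintype.card ι →
      ∀ α : ι → ℚ, (∀ i, α i ≠ 0 ∧ α i ≠ 1 ∧ α i ≠ -1) →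
      ∀ β : ℚ, β ≠ 0 → ∀ s : ℤ, (s = 1 ∨ s = -1) → ∀ b : ι → ℤ,
        (∏ i, α i ^ b i) * β ^ s - 1 ≠ 0 →
      ∀ B : ℝ, (∀ i, (|b i| : ℝ) ≤ B) →
        2 * Real.exp 1 * 9 ^ (Fintype.card ι + 1) * (∏ i, logHeight₁ (α i)) *
            max (logHeight₁ β) 1 ≤ B →
        ∀ p : ℕ, p.Prime →
          -(egC6 (Fintype.card ι + 1) * (p / Real.log p) * (∏ i, logHeight₁ (α i)) *
              max (logHeight₁ β) 1 * logStar (B * p / max (logHeight₁ β) 1)) <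
            -(padicValRat p ((∏ i, α i ^ b i) * β ^ s - 1) : ℝ) * Real.log p) :
    stewartYu1991_upperBound :=
  stewartYu1991_of_bakerShapeBound (by norm_num) (bakerShapeBound_half_three_of_thm328Finite h328)

/-- **`BakerShapeBound (1/2) 3` from Yu's Theorem 3.2.7 over `ℚ` as printed (Yu 2007), alone.**
The hypothesis `hY` is verbatim that of `Dioph.thm328_rat_finite_of_yu`.
[cite: EvertseGyory2015, Thm 3.2.7 (p. 62)] -/
theorem bakerShapeBound_half_three_of_yu
    (hY : ∀ (κ : Type) [Fintype κ] [DecidableEq κ], 2 ≤ Fintype.card κ →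
      ∀ (α : κ → ℚ) (b : κ → ℤ) (k₀ : κ) (B Bn δ : ℝ) (p : ℕ), p.Prime →
        (∀ k, α k ≠ 0) → b k₀ ≠ 0 →
        (∀ k, b k ≠ 0 → padicValInt p (b k₀) ≤ padicValInt p (b k)) →
        (∀ k, (|b k| : ℝ) ≤ B) → Bn ≤ B → (|b k₀| : ℝ) ≤ Bn →
        ∏ k, α k ^ b k - 1 ≠ 0 → 0 < δ → δ ≤ 1 / 2 →
        (padicValRat p (∏ k, α k ^ b k - 1) : ℝ) <
          (16 * Real.exp 1) ^ (2 * (Fintype.card κ + 1)) * (Fintype.card κ : ℝ) ^ (3 / 2 : ℝ) *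
              Real.log (2 * Fintype.card κ) * Real.log 2 *
            (p / Real.log p ^ 2) *
            max ((∏ k, max (logHeight₁ (α k)) (1 / (16 * Real.exp 1 ^ 2))) *
                  Real.log (Bn * (2 * Real.exp 1 ^ ((Fintype.card κ + 1) *
                      (6 * Fintype.card κ + 5)) * Real.log 2) * (p : ℝ) ^ (Fintype.card κ + 1) *
                    (∏ k ∈ univ.erase k₀, max (logHeight₁ (α k)) (1 / (16 * Real.exp 1 ^ 2))) /
                    δ))
              (δ * B / (Bn * (2 ^ (2 * Fintype.card κ + 1) * Real.log 2 * Real.log 3 ^ 3)))) :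
    BakerShapeBound (1 / 2) 3 :=
  bakerShapeBound_half_three_of_thm328Finite (thm328_rat_finite_of_yu hY)

/-- **Stewart–Yu 1991 from Yu's Theorem 3.2.7 over `ℚ` as printed (Yu 2007), alone** — the
`p`-adic theory of logarithmic forms is the whole undischarged input of the named fact
`stewartYu1991_upperBound`. [cite: EvertseGyory2015, Thm 3.2.7 (p. 62)]
[cite: Waldschmidt2014, §2 (PDF p. 3)] [cite: StewartYu1991, main theorem] -/
theorem stewartYu1991_of_yu
    (hY : ∀ (κ : Type) [Fintype κ] [DecidableEq κ], 2 ≤ Fintype.card κ →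
      ∀ (α : κ → ℚ) (b : κ → ℤ) (k₀ : κ) (B Bn δ : ℝ) (p : ℕ), p.Prime →
        (∀ k, α k ≠ 0) → b k₀ ≠ 0 →
        (∀ k, b k ≠ 0 → padicValInt p (b k₀) ≤ padicValInt p (b k)) →
        (∀ k, (|b k| : ℝ) ≤ B) → Bn ≤ B → (|b k₀| : ℝ) ≤ Bn →
        ∏ k, α k ^ b k - 1 ≠ 0 → 0 < δ → δ ≤ 1 / 2 →
        (padicValRat p (∏ k, α k ^ b k - 1) : ℝ) <
          (16 * Real.exp 1) ^ (2 * (Fintype.card κ + 1)) * (Fintype.card κ : ℝ) ^ (3 / 2 : ℝ) *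
              Real.log (2 * Fintype.card κ) * Real.log 2 *
            (p / Real.log p ^ 2) *
            max ((∏ k, max (logHeight₁ (α k)) (1 / (16 * Real.exp 1 ^ 2))) *
                  Real.log (Bn * (2 * Real.exp 1 ^ ((Fintype.card κ + 1) *
                      (6 * Fintype.card κ + 5)) * Real.log 2) * (p : ℝ) ^ (Fintype.card κ + 1) *
                    (∏ k ∈ univ.erase k₀, max (logHeight₁ (α k)) (1 / (16 * Real.exp 1 ^ 2))) /
                    δ))
              (δ * B / (Bn * (2 ^ (2 * Fintype.card κ + 1) * Real.log 2 * Real.log 3 ^ 3)))) :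
    stewartYu1991_upperBound :=
  stewartYu1991_of_bakerShapeBound (by norm_num) (bakerShapeBound_half_three_of_yu hY)

/-- **Stewart–Yu 1991 from ANY `p`-adic bound of the shape of Evertse–Győry's Theorem 3.2.7
over `ℚ`** with constants `C₃(n) ≥ 0` subject to `C₃(n) · 7(n+1)² ≤ C₆(n,1)` (`n ≥ 2`)
(adapter `Dioph.thm328_rat_finite_of_padicBound`).
[cite: EvertseGyory2015, Thm 3.2.7 (p. 62), Thm 3.2.8 (p. 62)] [cite: Waldschmidt2014, §2 (PDF p. 3)] -/
theorem stewartYu1991_of_padicBound (C₃ : ℕ → ℝ) (hC₃0 : ∀ n, 2 ≤ n → 0 ≤ C₃ n)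
    (hC₃le : ∀ n, 2 ≤ n → C₃ n * (7 * ((n : ℝ) + 1) ^ 2) ≤ egC6 n)
    (hY : ∀ (κ : Type) [Fintype κ] [DecidableEq κ], 2 ≤ Fintype.card κ →
      ∀ (α : κ → ℚ) (b : κ → ℤ) (k₀ : κ) (B Bn δ : ℝ) (p : ℕ), p.Prime →
        (∀ k, α k ≠ 0) → b k₀ ≠ 0 →
        (∀ k, b k ≠ 0 → padicValInt p (b k₀) ≤ padicValInt p (b k)) →
        (∀ k, (|b k| : ℝ) ≤ B) → Bn ≤ B → (|b k₀| : ℝ) ≤ Bn →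
        ∏ k, α k ^ b k - 1 ≠ 0 → 0 < δ → δ ≤ 1 / 2 →
        (padicValRat p (∏ k, α k ^ b k - 1) : ℝ) <
          C₃ (Fintype.card κ) * (p / Real.log p ^ 2) *
            max ((∏ k, max (logHeight₁ (α k)) (1 / (16 * Real.exp 1 ^ 2))) *
                  Real.log (Bn * (2 * Real.exp 1 ^ ((Fintype.card κ + 1) *
                      (6 * Fintype.card κ + 5)) * Real.log 2) * (p : ℝ) ^ (Fintype.card κ + 1) *
                    (∏ k ∈ univ.erase k₀, max (logHeight₁ (α k)) (1 / (16 * Real.exp 1 ^ 2))) /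
                    δ))
              (δ * B / (Bn * (2 ^ (2 * Fintype.card κ + 1) * Real.log 2 * Real.log 3 ^ 3)))) :
    stewartYu1991_upperBound :=
  stewartYu1991_of_bakerShapeBound (by norm_num)
    (bakerShapeBound_half_three_of_thm328Finite (thm328_rat_finite_of_padicBound C₃ hC₃0 hC₃le hY))

end Corollaries

end Literature.Barriers.ABC

end
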